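import Literature.NumberTheory.Sieve.LinearEquationsInPrimesWTrick
import Mathlib.Analysis.SpecialFunctions.Pow.Asymptotics
import Mathlib.Analysis.SpecialFunctions.Pow.Real
import Mathlib.Analysis.Complex.ExponentialBounds
import Mathlib.Data.Nat.Log
import Mathlib.Data.Int.Interval
import HarnessLib

/-!
# Linear equations in primes: Conjecture 1.2 implies Conjecture 1.4 (Green–Tao 2010)

This file discharges the named fact
`Literature.NumberTheory.Sieve.generalizedHardyLittlewood_count_of_vonMangoldt` of
`Literature/NumberTheory/Sieve/LinearEquationsInPrimes.lean`:
the von Mangoldt-weighted generalised Hardy–Littlewood conjecture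
(`GeneralizedHardyLittlewood`, Green–Tao 2010, Conj. 1.2) implies its prime-counting form
(`GeneralizedHardyLittlewoodCount`, Conj. 1.4, eq. (1.8)), following the
"Sketch proof of Conjecture 1.4 assuming Conjecture 1.2" printed after (1.8) in
B. Green, T. Tao, *Linear equations in primes*, Ann. of Math. 171 (2010), §1.

## The argument

Fix `d, t ≥ 1`, `L`, and `0 < ε ≤ 1`; put `θ = 1 - ε/(4t)` and `ρ = N^θ`. For a system `Ψ` with
`‖Ψ‖_N ≤ L` (so `|ψᵢ(n)| ≤ LN` on `[-N,N]^d`) and a convex `K ⊆ [-N,N]^d`: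

* (crude estimates) a non-constant form takes each value at most `(2N+1)^{d-1}` times on the
  box (`card_filter_eval_eq_le` of `LinearEquationsInPrimesCrudeBounds`), so the lattice points
  with some value `ψᵢ(n) ∈ (0, ρ]` number
  `O(t N^{d-1} ρ)` and those with some higher-prime-power value `p^k ≤ LN`, `k ≥ 2`, number
  `O(t N^{d-1} √(LN) log(LN))` (`card_higherPrimePowers_le` of `LinearEquationsInPrimesWTrick`);
  both are `o(N^d / logᵗ N)` and carry weight `≤ logᵗ(LN)` each;
* on the remaining prime points the weight `∏ᵢ Λ(ψᵢ(n)) = ∏ᵢ log ψᵢ(n)` lies in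
  `[θᵗ logᵗ N, logᵗ(LN)]`, and `θᵗ ≥ 1 - ε/4`, `logᵗ(LN) ≤ (1 + ε/(4t))ᵗ logᵗ N ≤ e^{ε/4} logᵗ N`
  once `log L ≤ (ε/4t) log N`;
* Conjecture 1.2 applied to `K` itself (accuracy `ε/16`) then sandwiches the prime-point count
  (`count_endgame`), uniformly in `Ψ` and `K`; the largeness of `N` needed is expressed through
  `logᵏ N = o(N^η)` (`eventually_mul_log_pow_le_rpow`).

No bound on the singular product `∏_p β_p` (which need not be bounded uniformly in `Ψ`) is
needed: it only enters through the main term of Conjecture 1.2 for the single body `K`.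

## References

* B. Green, T. Tao, *Linear equations in primes*, Ann. of Math. (2) 171 (2010), 1753–1850
  (arXiv:math/0606088), §1: Conj. 1.2, Conj. 1.4 and the sketch proof following (1.8).
-/

noncomputable section

open Filter Finset
open scoped Topology ArithmeticFunction.vonMangoldt

namespace Literature.NumberTheory.Sieve

variable {d t : ℕ}

/-! ### Crude counting on the box `[-N, N]^d` -/

/-- Corollary of the fiber bound `card_filter_eval_eq_le` (a non-constant form takes each value
at most `(2N+1)^{d-1}` times on the box): the number of lattice points of `A ⊆ [-N,N]^d ∩ ℤ^d`
on which a non-constant form takes values in a finite set `s` is at most `(2N+1)^{d-1} · #s`.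
[folklore] -/
theorem card_filter_eval_mem_finset_le (N : ℕ) (ψ : AffLinForm d) (hψ : ψ.coeff ≠ 0) (s : Finset ℤ)
    (A : Finset (Fin d → ℤ)) (hA : A ⊆ latticeBox d N) :
    #(A.filter fun n => ψ.eval n ∈ s) ≤ (2 * N + 1) ^ (d - 1) * #s := by
  classical
  obtain ⟨j₀, hj₀⟩ : ∃ j, ψ.coeff j ≠ 0 := by
    by_contra! h
    exact hψ (funext h)
  refine Finset.card_le_mul_card_image_of_maps_to (f := ψ.eval) (fun n hn => (mem_filter.mp hn).2)
    _ fun v _ => ?_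
  calc #((A.filter fun n => ψ.eval n ∈ s).filter fun n => ψ.eval n = v)
      ≤ #((latticeBox d N).filter fun n => ψ.eval n = v) := by
        refine card_le_card fun n hn => ?_
        simp only [mem_filter] at hn ⊢
        exact ⟨hA hn.1.1, hn.2⟩
    _ ≤ (2 * N + 1) ^ (d - 1) := card_filter_eval_eq_le ψ hj₀ N v

/-- Each form of a system of size `‖Ψ‖_N ≤ L` is bounded by `L N` in absolute value on the box
`[-N, N]^d`. [cite: GreenTao2010, (1.1)] -/
theorem abs_eval_le_mul_of_affLinSize_le {N : ℕ} (hN : 0 < N) {L : ℝ} (Ψ : Fin t → AffLinForm d)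
    (hL : affLinSize Ψ N ≤ L) (i : Fin t) {n : Fin d → ℤ} (hn : n ∈ latticeBox d N) :
    |((Ψ i).eval n : ℝ)| ≤ L * N := by
  have hNr : (0 : ℝ) < N := by exact_mod_cast hN
  have hcoord : ∀ j, |(n j : ℝ)| ≤ N := fun j => by
    have h := Fintype.mem_piFinset.mp hn j
    rw [Finset.mem_Icc] at h
    rw [abs_le]
    exact ⟨by exact_mod_cast h.1, by exact_mod_cast h.2⟩
  have h1 : ∑ j, |((Ψ i).coeff j : ℝ)| + |((Ψ i).const : ℝ) / N| ≤ affLinSize Ψ N := by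
    unfold affLinSize
    refine add_le_add ?_ ?_
    · exact Finset.single_le_sum (f := fun i => ∑ j, |((Ψ i).coeff j : ℝ)|)
        (fun i _ => Finset.sum_nonneg fun j _ => abs_nonneg _) (mem_univ i)
    · exact Finset.single_le_sum (f := fun i => |((Ψ i).const : ℝ) / N|)
        (fun i _ => abs_nonneg _) (mem_univ i)
  have h2 : |((Ψ i).eval n : ℝ)| ≤
      N * (∑ j, |((Ψ i).coeff j : ℝ)| + |((Ψ i).const : ℝ) / N|) := by
    simp only [AffLinForm.eval, Int.cast_add, Int.cast_sum, Int.cast_mul]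
    calc |∑ j, ((Ψ i).coeff j : ℝ) * n j + (Ψ i).const|
        ≤ ∑ j, |((Ψ i).coeff j : ℝ) * n j| + |((Ψ i).const : ℝ)| :=
          (abs_add_le _ _).trans (by gcongr; exact Finset.abs_sum_le_sum_abs _ _)
      _ ≤ ∑ j, |((Ψ i).coeff j : ℝ)| * N + |((Ψ i).const : ℝ)| := by
          gcongr with j
          rw [abs_mul]
          gcongr
          exact hcoord j
      _ = N * (∑ j, |((Ψ i).coeff j : ℝ)| + |((Ψ i).const : ℝ) / N|) := by
          rw [abs_div, abs_of_pos hNr, ← Finset.sum_mul, mul_add, mul_div_cancel₀ _ hNr.ne']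
          ring
  calc |((Ψ i).eval n : ℝ)| ≤ _ := h2
    _ ≤ N * affLinSize Ψ N := by gcongr
    _ ≤ N * L := by gcongr
    _ = L * N := mul_comm _ _

/-- `c · logᵏ N ≤ N^η` for all large `N` (`η > 0`). [folklore] -/
theorem eventually_mul_log_pow_le_rpow (k : ℕ) (c η : ℝ) (hη : 0 < η) :
    ∀ᶠ N : ℕ in atTop, c * Real.log N ^ k ≤ (N : ℝ) ^ η := by
  have h := ((isLittleO_log_rpow_rpow_atTop (k : ℝ) hη).comp_tendsto
    tendsto_natCast_atTop_atTop).bound (show (0 : ℝ) < 1 / (|c| + 1) by positivity)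
  filter_upwards [h] with N hN
  simp only [Function.comp_def, Real.rpow_natCast, norm_pow, Real.norm_eq_abs] at hN
  have hNη : 0 ≤ (N : ℝ) ^ η := by positivity
  rw [abs_of_nonneg hNη] at hN
  calc c * Real.log N ^ k ≤ |c * Real.log N ^ k| := le_abs_self _
    _ = |c| * |Real.log N| ^ k := by rw [abs_mul, abs_pow]
    _ ≤ (|c| + 1) * |Real.log N| ^ k := by gcongr; linarith
    _ ≤ (|c| + 1) * (1 / (|c| + 1) * (N : ℝ) ^ η) := by gcongr
    _ = (N : ℝ) ^ η := by field_simp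

/-! ### Elementary real inequalities and the endgame -/

/-- Bernoulli: with `θ = 1 - ε/(4t)`, `(1 + ε/2) θᵗ ≥ 1` for `0 ≤ ε ≤ 1`; used to compare
`logᵗ N` with `logᵗ N^θ = θᵗ logᵗ N`. [folklore] -/
theorem one_le_mul_theta_pow {t : ℕ} (ht : 1 ≤ t) {ε : ℝ} (hε : 0 ≤ ε) (hε1 : ε ≤ 1) :
    1 ≤ (1 + ε / 2) * (1 - ε / (4 * t)) ^ t := by
  have htr : (1 : ℝ) ≤ t := by exact_mod_cast ht
  have hB : 1 + (t : ℝ) * (-(ε / (4 * t))) ≤ (1 + -(ε / (4 * t))) ^ t :=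
    one_add_mul_le_pow (by
      have : ε / (4 * t) ≤ 1 := by
        rw [div_le_one (by positivity)]; nlinarith
      linarith) t
  have h1 : 1 + (t : ℝ) * (-(ε / (4 * t))) = 1 - ε / 4 := by field_simp; ring
  rw [h1, ← sub_eq_add_neg] at hB
  calc (1 : ℝ) ≤ (1 + ε / 2) * (1 - ε / 4) := by nlinarith
    _ ≤ (1 + ε / 2) * (1 - ε / (4 * t)) ^ t := by gcongr

/-- `(1 - ε/2) (1 + ε/(4t))ᵗ ≤ 1` (via `(1 + x/t)ᵗ ≤ eˣ` and `1 - 2x ≤ e^{-2x}`); used to compare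
`logᵗ (LN)` with `logᵗ N` once `log L ≤ (ε/4t) log N`. [folklore] -/
theorem mul_one_add_pow_le_one {t : ℕ} (ht : 1 ≤ t) {ε : ℝ} (hε : 0 ≤ ε) :
    (1 - ε / 2) * (1 + ε / (4 * t)) ^ t ≤ 1 := by
  have htpos : (0 : ℝ) < t := by exact_mod_cast ht
  have h1 : (1 + ε / (4 * t)) ^ t ≤ Real.exp (ε / 4) := by
    calc (1 + ε / (4 * t)) ^ t ≤ Real.exp (ε / (4 * t)) ^ t := by
          gcongr
          linarith [Real.add_one_le_exp (ε / (4 * t))]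
      _ = Real.exp (t * (ε / (4 * t))) := (Real.exp_nat_mul _ _).symm
      _ = Real.exp (ε / 4) := by congr 1; field_simp
  have h2 : 1 - ε / 2 ≤ Real.exp (-(ε / 2)) := by
    have := Real.add_one_le_exp (-(ε / 2)); linarith
  by_cases hneg : 1 - ε / 2 ≤ 0
  · calc (1 - ε / 2) * (1 + ε / (4 * t)) ^ t ≤ 0 :=
          mul_nonpos_of_nonpos_of_nonneg hneg (by positivity)
      _ ≤ 1 := zero_le_one
  have hpos := not_le.mp hneg
  calc (1 - ε / 2) * (1 + ε / (4 * t)) ^ t ≤ Real.exp (-(ε / 2)) * Real.exp (ε / 4) := by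
        gcongr
    _ = Real.exp (-(ε / 4)) := by rw [← Real.exp_add]; congr 1; ring
    _ ≤ 1 := by rw [Real.exp_le_one_iff]; linarith

/-- **Endgame.** The real-arithmetic heart of the derivation of Conjecture 1.4 from
Conjecture 1.2: `A` = number of prime points all of whose coordinates `ψᵢ(n)` are `≥ ρ`,
`C` = number of all prime points, `Wg` = von Mangoldt weight of the former, `R` = the remaining
weight, `S = Wg + R` = the full von Mangoldt sum, `X = β_∞ ∏ β_p`, `ℓ = log N`, `ℓρ = log ρ`,
`ℓL = log (LN)`, `Nd = N^d`. [cite: GreenTao2010, §1 sketch proof of Conj. 1.4] -/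
theorem count_endgame {t : ℕ} {ε Nd ℓ ℓρ ℓL A C Bmax S Wg R X : ℝ}
    (hε : 0 < ε) (hε1 : ε ≤ 1) (hNd : 0 < Nd) (hℓ : 0 < ℓ)
    (h7 : ℓ ^ t ≤ (1 + ε / 2) * ℓρ ^ t) (h8 : (1 - ε / 2) * ℓL ^ t ≤ ℓ ^ t)
    (hA : 0 ≤ A) (hCA : A ≤ C) (hC : C ≤ A + Bmax)
    (hWg1 : ℓρ ^ t * A ≤ Wg) (hWg2 : Wg ≤ ℓL ^ t * A)
    (hS : S = Wg + R) (hR0 : 0 ≤ R) (hWg0 : 0 ≤ Wg)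
    (hGHL : |S - X| ≤ ε / 16 * Nd)
    (hB : Bmax * ℓ ^ t ≤ ε / 4 * Nd) (hR : R ≤ ε / 4 * Nd) :
    |C - X / ℓ ^ t| ≤ ε * (X + Nd) / ℓ ^ t := by
  have hℓt : 0 < ℓ ^ t := pow_pos hℓ t
  have hGHL' := abs_le.mp hGHL
  have hX : -(ε / 16 * Nd) ≤ X := by linarith [hGHL'.2]
  have p1 : ε * (-(ε / 16 * Nd)) ≤ ε * X := mul_le_mul_of_nonneg_left hX hε.le
  have p2 : ε * (ε * Nd) ≤ 1 * (ε * Nd) := mul_le_mul_of_nonneg_right hε1 (by positivity)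
  have p3 : 0 ≤ ε * R := by positivity
  rw [show C - X / ℓ ^ t = (C * ℓ ^ t - X) / ℓ ^ t by field_simp, abs_div, abs_of_pos hℓt]
  refine div_le_div_of_nonneg_right (abs_le.mpr ⟨?_, ?_⟩) hℓt.le
  · -- lower bound
    have h1 : (1 - ε / 2) * (ℓL ^ t * A) ≤ C * ℓ ^ t := by
      calc (1 - ε / 2) * (ℓL ^ t * A) = ((1 - ε / 2) * ℓL ^ t) * A := by ring
        _ ≤ ℓ ^ t * A := by gcongr
        _ ≤ ℓ ^ t * C := by gcongr
        _ = C * ℓ ^ t := mul_comm _ _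
    have h2 : X - ε / 16 * Nd - R ≤ Wg := by linarith [hGHL'.1]
    have h3 : (1 - ε / 2) * (X - ε / 16 * Nd - R) ≤ (1 - ε / 2) * (ℓL ^ t * A) := by
      gcongr
      · linarith
      · linarith
    linarith
  · -- upper bound
    have h1 : C * ℓ ^ t ≤ (1 + ε / 2) * Wg + ε / 4 * Nd := by
      calc C * ℓ ^ t ≤ (A + Bmax) * ℓ ^ t := by gcongr
        _ = A * ℓ ^ t + Bmax * ℓ ^ t := by ring
        _ ≤ A * ((1 + ε / 2) * ℓρ ^ t) + ε / 4 * Nd := by gcongr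
        _ = (1 + ε / 2) * (ℓρ ^ t * A) + ε / 4 * Nd := by ring
        _ ≤ (1 + ε / 2) * Wg + ε / 4 * Nd := by gcongr
    have h2 : Wg ≤ X + ε / 16 * Nd := by linarith [hGHL'.2]
    have h3 : (1 + ε / 2) * Wg ≤ (1 + ε / 2) * (X + ε / 16 * Nd) := by gcongr
    linarith

/-! ### Weights and the decomposition of the lattice points of `K` -/

/-- An integer whose `Int.toNat` is at least `1` is nonnegative and equals the cast of its
`toNat`. [folklore] -/
theorem toNat_pos_aux {m : ℤ} {k : ℕ} (hk : 1 ≤ k) (h : k ≤ m.toNat) : 0 ≤ m ∧ ((m.toNat : ℕ) : ℤ) = m := by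
  have h0 : 0 ≤ m := by
    by_contra h0
    rw [Int.toNat_eq_zero.mpr (not_le.mp h0).le] at h
    omega
  exact ⟨h0, Int.toNat_of_nonneg h0⟩

/-- The von Mangoldt weight `∏ᵢ Λ(ψᵢ(n))` is nonnegative. [folklore] -/
theorem weight_nonneg (Ψ : Fin t → AffLinForm d) (n : Fin d → ℤ) :
    0 ≤ ∏ i, intVonMangoldt ((Ψ i).eval n) :=
  prod_nonneg fun _ _ => ArithmeticFunction.vonMangoldt_nonneg

/-- On the box, every weight is at most `logᵗ (LN)` (each `Λ(ψᵢ(n)) ≤ log ψᵢ(n) ≤ log (LN)`).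
[cite: GreenTao2010, §1 sketch proof of Conj. 1.4] -/
theorem weight_le_log_pow {N : ℕ} (hN : 0 < N) {L : ℝ} (hL1 : 1 ≤ L) (Ψ : Fin t → AffLinForm d)
    (hL : affLinSize Ψ N ≤ L) {n : Fin d → ℤ} (hn : n ∈ latticeBox d N) :
    ∏ i, intVonMangoldt ((Ψ i).eval n) ≤ Real.log (L * N) ^ t := by
  have hLN : 1 ≤ L * N := by
    have : (1 : ℝ) ≤ N := by exact_mod_cast hN
    nlinarith
  calc ∏ i, intVonMangoldt ((Ψ i).eval n) ≤ ∏ _i : Fin t, Real.log (L * N) := by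
        refine prod_le_prod (fun i _ => ArithmeticFunction.vonMangoldt_nonneg) fun i _ => ?_
        unfold intVonMangoldt
        refine ArithmeticFunction.vonMangoldt_le_log.trans ?_
        rcases Nat.eq_zero_or_pos ((Ψ i).eval n).toNat with h0 | hpos
        · rw [h0, Nat.cast_zero, Real.log_zero]
          exact Real.log_nonneg hLN
        · refine Real.log_le_log (by exact_mod_cast hpos) ?_
          obtain ⟨_, hm⟩ := toNat_pos_aux le_rfl hpos
          have habs := abs_eval_le_mul_of_affLinSize_le hN Ψ hL i hn
          have hcast : (((Ψ i).eval n).toNat : ℝ) = ((Ψ i).eval n : ℝ) := by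
            exact_mod_cast hm
          rw [hcast]
          exact (le_abs_self _).trans habs
    _ = Real.log (L * N) ^ t := Fin.prod_const _ _

/-- For a prime point all of whose values are `≥ ρ ≥ 1`, the weight is `∏ᵢ log ψᵢ(n)` and lies
between `logᵗ ρ` and `logᵗ (LN)`. [cite: GreenTao2010, §1 sketch proof of Conj. 1.4] -/
theorem weight_bounds_of_prime {N : ℕ} (hN : 0 < N) {L : ℝ} (hL1 : 1 ≤ L)
    (Ψ : Fin t → AffLinForm d) (hL : affLinSize Ψ N ≤ L) {ρ : ℝ} (hρ : 1 ≤ ρ) {n : Fin d → ℤ}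
    (hn : n ∈ latticeBox d N) (hp : ∀ i, ((Ψ i).eval n).toNat.Prime)
    (hge : ∀ i, ρ ≤ ((Ψ i).eval n : ℝ)) :
    Real.log ρ ^ t ≤ ∏ i, intVonMangoldt ((Ψ i).eval n) ∧
      ∏ i, intVonMangoldt ((Ψ i).eval n) ≤ Real.log (L * N) ^ t := by
  refine ⟨?_, weight_le_log_pow hN hL1 Ψ hL hn⟩
  have hw : ∀ i, intVonMangoldt ((Ψ i).eval n) = Real.log ((Ψ i).eval n : ℝ) := fun i => by
    rw [intVonMangoldt, ArithmeticFunction.vonMangoldt_apply_prime (hp i)]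
    obtain ⟨_, hm⟩ := toNat_pos_aux one_le_two ((hp i).two_le)
    congr 1
    exact_mod_cast hm
  calc Real.log ρ ^ t = ∏ _i : Fin t, Real.log ρ := (Fin.prod_const _ _).symm
    _ ≤ ∏ i, intVonMangoldt ((Ψ i).eval n) := by
        refine prod_le_prod (fun i _ => Real.log_nonneg hρ) fun i _ => ?_
        rw [hw i]
        exact Real.log_le_log (by linarith) (hge i)

open Classical in
/-- Every prime point either has all values `≥ ρ` or has some value in `(0, ⌊ρ⌋]`.
[cite: GreenTao2010, §1 sketch proof of Conj. 1.4] -/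
theorem primePointCount_le_card_add (N : ℕ) (Ψ : Fin t → AffLinForm d) (K : Set (Fin d → ℝ))
    (ρ : ℝ) :
    primePointCount Ψ K N ≤
      #(((latticeBox d N).filter fun n =>
          realPoint n ∈ K ∧ ∀ i, ((Ψ i).eval n).toNat.Prime).filter
          fun n => ∀ i, ρ ≤ ((Ψ i).eval n : ℝ)) +
      #((latticeBox d N).filter fun n => ∃ i, (Ψ i).eval n ∈ Finset.Ioc (0 : ℤ) ⌊ρ⌋) := by
  unfold primePointCount
  refine (card_le_card fun n hn => ?_).trans (card_union_le _ _)
  rw [mem_union]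
  by_cases h : ∀ i, ρ ≤ ((Ψ i).eval n : ℝ)
  · exact Or.inl (mem_filter.mpr ⟨hn, h⟩)
  · right
    obtain ⟨i, hi⟩ := not_forall.mp h
    rw [mem_filter] at hn ⊢
    refine ⟨hn.1, i, ?_⟩
    obtain ⟨h0, hm⟩ := toNat_pos_aux one_le_two ((hn.2.2 i).two_le)
    rw [Finset.mem_Ioc]
    refine ⟨?_, Int.le_floor.mpr (not_le.mp hi).le⟩
    have := (hn.2.2 i).two_le
    omega

/-- The lattice points of the box with some value in `(0, ⌊ρ⌋]` number at most
`t (2N+1)^{d-1} ⌊ρ⌋` (fiber bound). [cite: GreenTao2010, §1 sketch proof of Conj. 1.4] -/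
theorem card_small_values_le (N : ℕ) (Ψ : Fin t → AffLinForm d) (hΨ0 : ∀ i, (Ψ i).coeff ≠ 0)
    (ρ : ℝ) :
    #((latticeBox d N).filter fun n => ∃ i, (Ψ i).eval n ∈ Finset.Ioc (0 : ℤ) ⌊ρ⌋) ≤
      t * ((2 * N + 1) ^ (d - 1) * ⌊ρ⌋₊) := by
  classical
  calc #((latticeBox d N).filter fun n => ∃ i, (Ψ i).eval n ∈ Finset.Ioc (0 : ℤ) ⌊ρ⌋)
      ≤ #(Finset.univ.biUnion fun i =>
          (latticeBox d N).filter fun n => (Ψ i).eval n ∈ Finset.Ioc (0 : ℤ) ⌊ρ⌋) := by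
        refine card_le_card fun n hn => ?_
        simp only [mem_filter, mem_biUnion, mem_univ, true_and] at hn ⊢
        obtain ⟨hn, i, hi⟩ := hn
        exact ⟨i, hn, hi⟩
    _ ≤ ∑ i, #((latticeBox d N).filter fun n => (Ψ i).eval n ∈ Finset.Ioc (0 : ℤ) ⌊ρ⌋) :=
        card_biUnion_le
    _ ≤ ∑ _i : Fin t, (2 * N + 1) ^ (d - 1) * ⌊ρ⌋₊ := sum_le_sum fun i _ => by
        have h := card_filter_eval_mem_finset_le N (Ψ i) (hΨ0 i) (Finset.Ioc (0 : ℤ) ⌊ρ⌋)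
          (latticeBox d N) subset_rfl
        rwa [Int.card_Ioc, sub_zero, Int.floor_toNat] at h
    _ = t * ((2 * N + 1) ^ (d - 1) * ⌊ρ⌋₊) := by
        rw [sum_const, card_univ, Fintype.card_fin, smul_eq_mul]

/-- The lattice points of the box at which some form takes a higher-prime-power value
`p^k ≤ M` (`k ≥ 2`) number at most `t (2N+1)^{d-1} (√M + 1)(log₂ M + 1)`.
[cite: GreenTao2010, §1 sketch proof of Conj. 1.4] -/
theorem card_higherPrimePower_values_le (N : ℕ) (Ψ : Fin t → AffLinForm d)
    (hΨ0 : ∀ i, (Ψ i).coeff ≠ 0) (M : ℕ) :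
    #((latticeBox d N).filter fun n => ∃ i, ((Ψ i).eval n).toNat ∈
        (range (M + 1)).filter fun m => IsPrimePow m ∧ ¬ m.Prime) ≤
      t * ((2 * N + 1) ^ (d - 1) * ((Nat.sqrt M + 1) * (Nat.log 2 M + 1))) := by
  classical
  set H := (range (M + 1)).filter fun m => IsPrimePow m ∧ ¬ m.Prime with hH
  calc #((latticeBox d N).filter fun n => ∃ i, ((Ψ i).eval n).toNat ∈ H)
      ≤ #(Finset.univ.biUnion fun i =>
          (latticeBox d N).filter fun n => (Ψ i).eval n ∈ H.image (Nat.cast : ℕ → ℤ)) := by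
        refine card_le_card fun n hn => ?_
        simp only [mem_filter, mem_biUnion, mem_univ, true_and] at hn ⊢
        obtain ⟨hn, i, hi⟩ := hn
        refine ⟨i, hn, mem_image.mpr ⟨_, hi, ?_⟩⟩
        have h2 : 2 ≤ ((Ψ i).eval n).toNat := by
          have := (mem_filter.mp hi).2.1
          exact this.two_le
        exact (toNat_pos_aux one_le_two h2).2
    _ ≤ ∑ i, #((latticeBox d N).filter fun n => (Ψ i).eval n ∈ H.image (Nat.cast : ℕ → ℤ)) :=
        card_biUnion_le
    _ ≤ ∑ _i : Fin t, (2 * N + 1) ^ (d - 1) * ((Nat.sqrt M + 1) * (Nat.log 2 M + 1)) :=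
        sum_le_sum fun i _ => by
          calc _ ≤ (2 * N + 1) ^ (d - 1) * #(H.image (Nat.cast : ℕ → ℤ)) :=
                card_filter_eval_mem_finset_le N (Ψ i) (hΨ0 i) _ _ subset_rfl
            _ ≤ _ := by
                gcongr
                exact card_image_le.trans (card_higherPrimePowers_le M)
    _ = t * ((2 * N + 1) ^ (d - 1) * ((Nat.sqrt M + 1) * (Nat.log 2 M + 1))) := by
        rw [sum_const, card_univ, Fintype.card_fin, smul_eq_mul]

open Classical in
/-- The lattice points of `K` with nonzero weight that are not prime points with all values
`≥ ρ` have either a (prime) value in `(0, ⌊ρ⌋]` or a higher-prime-power value `≤ LN`.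
[cite: GreenTao2010, §1 sketch proof of Conj. 1.4] -/
theorem rest_subset {N : ℕ} (hN : 0 < N) (L : ℕ) (Ψ : Fin t → AffLinForm d)
    (hL : affLinSize Ψ N ≤ L) (K : Set (Fin d → ℝ)) (ρ : ℝ) :
    ((((latticeBox d N).filter fun n => realPoint n ∈ K) \
        (((latticeBox d N).filter fun n =>
          realPoint n ∈ K ∧ ∀ i, ((Ψ i).eval n).toNat.Prime).filter
          fun n => ∀ i, ρ ≤ ((Ψ i).eval n : ℝ))).filter
        fun n => ∏ i, intVonMangoldt ((Ψ i).eval n) ≠ 0) ⊆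
      ((latticeBox d N).filter fun n => ∃ i, (Ψ i).eval n ∈ Finset.Ioc (0 : ℤ) ⌊ρ⌋) ∪
      ((latticeBox d N).filter fun n => ∃ i, ((Ψ i).eval n).toNat ∈
        (range (L * N + 1)).filter fun m => IsPrimePow m ∧ ¬ m.Prime) := by
  intro n hn
  rw [Finset.mem_filter] at hn
  obtain ⟨hn1, hw⟩ := hn
  rw [Finset.mem_sdiff] at hn1
  obtain ⟨hnF, hnot⟩ := hn1
  rw [Finset.mem_filter] at hnF
  obtain ⟨hnbox, hnK⟩ := hnF
  have hpp : ∀ i, IsPrimePow ((Ψ i).eval n).toNat := fun i =>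
    ArithmeticFunction.vonMangoldt_ne_zero_iff.mp (prod_ne_zero_iff.mp hw i (mem_univ i))
  rw [mem_union, mem_filter, mem_filter]
  by_cases hall : ∀ i, ((Ψ i).eval n).toNat.Prime
  · left
    have hnot' : ¬ ∀ i, ρ ≤ ((Ψ i).eval n : ℝ) := fun h =>
      hnot (Finset.mem_filter.mpr ⟨Finset.mem_filter.mpr ⟨hnbox, hnK, hall⟩, h⟩)
    obtain ⟨i, hi⟩ := not_forall.mp hnot'
    refine ⟨hnbox, i, ?_⟩
    rw [Finset.mem_Ioc]
    have h2 := (hall i).two_le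
    refine ⟨by omega, Int.le_floor.mpr (not_le.mp hi).le⟩
  · right
    obtain ⟨i, hi⟩ := not_forall.mp hall
    refine ⟨hnbox, i, mem_filter.mpr ⟨?_, hpp i, hi⟩⟩
    rw [mem_range, Nat.lt_succ_iff]
    obtain ⟨h0, hm⟩ := toNat_pos_aux one_le_two (hpp i).two_le
    have habs := abs_eval_le_mul_of_affLinSize_le hN Ψ hL i hnbox
    have h1 : ((Ψ i).eval n : ℝ) ≤ ((L * N : ℕ) : ℤ) := by
      push_cast
      exact (le_abs_self _).trans habs
    exact Int.toNat_le.mpr (by exact_mod_cast h1)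

open Classical in
/-- The weight carried by the lattice points of `K` other than the prime points with all values
`≥ ρ` is at most `logᵗ(LN) · (#small values + #higher prime power values)`.
[cite: GreenTao2010, §1 sketch proof of Conj. 1.4] -/
theorem rest_weight_le {N : ℕ} (hN : 0 < N) (L : ℕ) (hL1 : 1 ≤ L) (Ψ : Fin t → AffLinForm d)
    (hL : affLinSize Ψ N ≤ L) (K : Set (Fin d → ℝ)) (ρ : ℝ) :
    ∑ n ∈ ((latticeBox d N).filter fun n => realPoint n ∈ K) \
        (((latticeBox d N).filter fun n =>
          realPoint n ∈ K ∧ ∀ i, ((Ψ i).eval n).toNat.Prime).filter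
          fun n => ∀ i, ρ ≤ ((Ψ i).eval n : ℝ)),
        ∏ i, intVonMangoldt ((Ψ i).eval n) ≤
      Real.log (L * N) ^ t *
        (#((latticeBox d N).filter fun n => ∃ i, (Ψ i).eval n ∈ Finset.Ioc (0 : ℤ) ⌊ρ⌋) +
         #((latticeBox d N).filter fun n => ∃ i, ((Ψ i).eval n).toNat ∈
            (range (L * N + 1)).filter fun m => IsPrimePow m ∧ ¬ m.Prime)) := by
  have hL1r : (1 : ℝ) ≤ L := by exact_mod_cast hL1
  rw [← sum_filter_ne_zero]
  have hsub := rest_subset hN L Ψ hL K ρ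
  calc ∑ n ∈ _, ∏ i, intVonMangoldt ((Ψ i).eval n)
      ≤ ∑ _n ∈ ((((latticeBox d N).filter fun n => realPoint n ∈ K) \
        (((latticeBox d N).filter fun n =>
          realPoint n ∈ K ∧ ∀ i, ((Ψ i).eval n).toNat.Prime).filter
          fun n => ∀ i, ρ ≤ ((Ψ i).eval n : ℝ))).filter
        fun n => ∏ i, intVonMangoldt ((Ψ i).eval n) ≠ 0), Real.log (L * N) ^ t := by
        refine sum_le_sum fun n hn => weight_le_log_pow hN hL1r Ψ hL ?_
        rw [Finset.mem_filter] at hn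
        obtain ⟨hn1, _⟩ := hn
        rw [Finset.mem_sdiff] at hn1
        obtain ⟨hnF, _⟩ := hn1
        rw [Finset.mem_filter] at hnF
        exact hnF.1
    _ = #_ * Real.log (L * N) ^ t := by rw [sum_const, nsmul_eq_mul]
    _ ≤ (#((latticeBox d N).filter fun n => ∃ i, (Ψ i).eval n ∈ Finset.Ioc (0 : ℤ) ⌊ρ⌋) +
         #((latticeBox d N).filter fun n => ∃ i, ((Ψ i).eval n).toNat ∈
            (range (L * N + 1)).filter fun m => IsPrimePow m ∧ ¬ m.Prime) : ℕ) *
          Real.log (L * N) ^ t := by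
        have hlog : 0 ≤ Real.log (L * N) ^ t := by
          apply pow_nonneg
          apply Real.log_nonneg
          have : (1 : ℝ) ≤ N := by exact_mod_cast hN
          nlinarith
        gcongr
        exact (card_le_card hsub).trans (card_union_le _ _)
    _ = _ := by push_cast; ring

/-! ### The derivation -/

set_option maxHeartbeats 400000 in
/-- **Green–Tao 2010, Conjecture 1.2 ⇒ Conjecture 1.4** ("Sketch proof of Conjecture 1.4
assuming Conjecture 1.2", after (1.8)): the von Mangoldt-weighted generalised Hardy–Littlewood
conjecture implies its prime-counting form. Following the printed sketch: prime points with some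
value `ψᵢ(n) ≤ N^θ` (`θ = 1 - ε/4t`) and lattice points with a higher-prime-power value are
negligible by crude (fiber) counting, and on the remaining prime points the weight
`∏ᵢ Λ(ψᵢ(n)) = ∏ᵢ log ψᵢ(n)` is `logᵗ N` up to a factor in `[θᵗ, (1 + log L/log N)ᵗ]`.
[cite: GreenTao2010, Conj. 1.4 and sketch proof after (1.8)] -/
theorem generalizedHardyLittlewood_count_of_vonMangoldt_holds :
    generalizedHardyLittlewood_count_of_vonMangoldt := by
  intro hGHL d t L hd ht ε hε
  classical
  have htr : (1 : ℝ) ≤ t := by exact_mod_cast ht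
  -- `L = 0`: no non-degenerate system has size `≤ 0`, the statement is vacuous.
  rcases Nat.eq_zero_or_pos L with rfl | hLpos
  · refine ⟨1, fun N _ Ψ hΨ hL K _ _ => ?_⟩
    exfalso
    obtain ⟨j, hj⟩ : ∃ j, (Ψ ⟨0, ht⟩).coeff j ≠ 0 := by
      by_contra! h
      exact hΨ.1 ⟨0, ht⟩ (funext h)
    have h1 : (1 : ℝ) ≤ affLinSize Ψ N := by
      unfold affLinSize
      have hj' : (1 : ℝ) ≤ |((Ψ ⟨0, ht⟩).coeff j : ℝ)| := by
        have : (1 : ℤ) ≤ |(Ψ ⟨0, ht⟩).coeff j| := Int.one_le_abs hj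
        exact_mod_cast this
      calc (1 : ℝ) ≤ |((Ψ ⟨0, ht⟩).coeff j : ℝ)| := hj'
        _ ≤ ∑ j', |((Ψ ⟨0, ht⟩).coeff j' : ℝ)| :=
            single_le_sum (f := fun j' => |((Ψ ⟨0, ht⟩).coeff j' : ℝ)|)
              (fun _ _ => abs_nonneg _) (mem_univ j)
        _ ≤ ∑ i, ∑ j', |((Ψ i).coeff j' : ℝ)| :=
            single_le_sum (f := fun i => ∑ j', |((Ψ i).coeff j' : ℝ)|)
              (fun _ _ => sum_nonneg fun _ _ => abs_nonneg _) (mem_univ _)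
        _ ≤ _ := le_add_of_nonneg_right (sum_nonneg fun _ _ => abs_nonneg _)
    have h2 : affLinSize Ψ N ≤ ((0 : ℕ) : ℝ) := hL
    rw [Nat.cast_zero] at h2
    linarith
  -- parameters: `ε₁ = min ε 1`, `θ = 1 - ε₁/(4t)`, GHL at accuracy `ε₁/16`
  set ε₁ : ℝ := min ε 1 with hε₁def
  have hε₁pos : 0 < ε₁ := lt_min hε one_pos
  have hε₁1 : ε₁ ≤ 1 := min_le_right _ _
  have hε₁ε : ε₁ ≤ ε := min_le_left _ _
  have htpos : (0 : ℝ) < t := by linarith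
  set θ : ℝ := 1 - ε₁ / (4 * t) with hθdef
  have hquarter : ε₁ / (4 * t) ≤ 1 / 4 := by
    rw [div_le_iff₀ (by positivity)]
    linarith
  have hθ1 : θ < 1 := by
    rw [hθdef]
    have : 0 < ε₁ / (4 * t) := by positivity
    linarith
  have hθ0 : 0 < θ := by rw [hθdef]; linarith
  obtain ⟨N₁, hN₁⟩ := hGHL d t L hd ht (ε₁ / 16) (by positivity)
  -- all the largeness conditions on `N`
  have hev : ∀ᶠ N : ℕ in atTop, N₁ ≤ N ∧ 3 ≤ N ∧ Real.log L ≤ ε₁ / (4 * t) * Real.log N ∧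
      (8 * 2 ^ t * t * 3 ^ (d - 1) / ε₁) * Real.log N ^ t ≤ (N : ℝ) ^ (1 - θ) ∧
      (80 * 2 ^ t * t * 3 ^ (d - 1) * Real.sqrt L / ε₁) * Real.log N ^ (t + 1) ≤
        (N : ℝ) ^ (1 / 2 : ℝ) := by
    refine (eventually_ge_atTop N₁).and ((eventually_ge_atTop 3).and (Eventually.and ?_
      ((eventually_mul_log_pow_le_rpow t _ (1 - θ) (by linarith)).and
        (eventually_mul_log_pow_le_rpow (t + 1) _ (1 / 2) (by norm_num)))))
    have h := (Real.tendsto_log_atTop.comp tendsto_natCast_atTop_atTop).eventually_ge_atTop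
      (Real.log L / (ε₁ / (4 * t)))
    filter_upwards [h] with N hN
    have h' := (div_le_iff₀ (by positivity)).mp hN
    simpa [mul_comm] using h'
  obtain ⟨N₀, hN₀⟩ := eventually_atTop.mp hev
  refine ⟨N₀, fun N hN Ψ hΨ hL K hK hKN => ?_⟩
  obtain ⟨hNN₁, hN3, hlogL, hc₁, hc₂⟩ := hN₀ N hN
  -- positivity bookkeeping
  have hNpos : 0 < N := by omega
  have hNr : (0 : ℝ) < N := by exact_mod_cast hNpos
  have hN3r : (3 : ℝ) ≤ N := by exact_mod_cast hN3
  have hL1 : 1 ≤ L := hLpos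
  have hL1r : (1 : ℝ) ≤ L := by exact_mod_cast hL1
  have hd' : d - 1 + 1 = d := Nat.sub_add_cancel hd
  set ℓ : ℝ := Real.log N with hℓdef
  have hℓ1 : 1 ≤ ℓ := by
    rw [hℓdef, Real.le_log_iff_exp_le hNr]
    have := Real.exp_one_lt_d9
    linarith
  have hℓpos : 0 < ℓ := by linarith
  have h2t : (1 : ℝ) ≤ 2 ^ t := one_le_pow₀ (by norm_num)
  -- the threshold `ρ = N^θ`
  set ρ : ℝ := (N : ℝ) ^ θ with hρdef
  have hρ1 : 1 ≤ ρ := Real.one_le_rpow (by exact_mod_cast hNpos) hθ0.le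
  have hlogρ : Real.log ρ = θ * ℓ := Real.log_rpow hNr θ
  -- Conjecture 1.2 for `K` itself
  have hG := hN₁ N hNN₁ Ψ hΨ hL K hK hKN
  -- the finsets: lattice points of `K`, good prime points, small values, higher prime powers
  set F := (latticeBox d N).filter fun n => realPoint n ∈ K with hFdef
  set Pg := ((latticeBox d N).filter fun n =>
      realPoint n ∈ K ∧ ∀ i, ((Ψ i).eval n).toNat.Prime).filter
      fun n => ∀ i, ρ ≤ ((Ψ i).eval n : ℝ) with hPgdef
  have hPgF : Pg ⊆ F := by
    intro n hn
    rw [hPgdef, mem_filter, mem_filter] at hn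
    exact mem_filter.mpr ⟨hn.1.1, hn.1.2.1⟩
  -- `S = Wg + R`
  have hS : vonMangoldtSum Ψ K N = ∑ n ∈ Pg, ∏ i, intVonMangoldt ((Ψ i).eval n) +
      ∑ n ∈ F \ Pg, ∏ i, intVonMangoldt ((Ψ i).eval n) := by
    rw [vonMangoldtSum, ← sum_sdiff hPgF, add_comm]
  have hWg0 : 0 ≤ ∑ n ∈ Pg, ∏ i, intVonMangoldt ((Ψ i).eval n) :=
    sum_nonneg fun n _ => weight_nonneg Ψ n
  have hR0 : 0 ≤ ∑ n ∈ F \ Pg, ∏ i, intVonMangoldt ((Ψ i).eval n) :=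
    sum_nonneg fun n _ => weight_nonneg Ψ n
  -- weights of the good prime points
  have hWg1 : Real.log ρ ^ t * #Pg ≤ ∑ n ∈ Pg, ∏ i, intVonMangoldt ((Ψ i).eval n) := by
    rw [mul_comm, ← nsmul_eq_mul, ← sum_const]
    refine sum_le_sum fun n hn => ?_
    rw [hPgdef, mem_filter, mem_filter] at hn
    exact (weight_bounds_of_prime hNpos hL1r Ψ hL hρ1 hn.1.1 hn.1.2.2 hn.2).1
  have hWg2 : ∑ n ∈ Pg, ∏ i, intVonMangoldt ((Ψ i).eval n) ≤ Real.log (L * N) ^ t * #Pg := by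
    rw [mul_comm, ← nsmul_eq_mul, ← sum_const]
    refine sum_le_sum fun n hn => ?_
    rw [hPgdef, mem_filter, mem_filter] at hn
    exact (weight_bounds_of_prime hNpos hL1r Ψ hL hρ1 hn.1.1 hn.1.2.2 hn.2).2
  -- counting
  have hC1 : #Pg ≤ primePointCount Ψ K N := card_le_card (filter_subset _ _)
  have hC2 := primePointCount_le_card_add N Ψ K ρ
  have hBad := card_small_values_le N Ψ hΨ.1 ρ
  have hHPc := card_higherPrimePower_values_le N Ψ hΨ.1 (L * N)
  have hRest := rest_weight_le hNpos L hL1 Ψ hL K ρ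
  -- comparison of `log ρ`, `log (LN)` with `log N`
  have h7 : ℓ ^ t ≤ (1 + ε₁ / 2) * Real.log ρ ^ t := by
    rw [hlogρ, mul_pow, ← mul_assoc]
    have h := one_le_mul_theta_pow ht hε₁pos.le hε₁1
    rw [← hθdef] at h
    calc ℓ ^ t = 1 * ℓ ^ t := (one_mul _).symm
      _ ≤ ((1 + ε₁ / 2) * θ ^ t) * ℓ ^ t := by gcongr
  have hLN : Real.log (L * N) = Real.log L + ℓ := Real.log_mul (by positivity) hNr.ne'
  have hlog0 : 0 ≤ Real.log (L * N) := by rw [hLN]; linarith [Real.log_nonneg hL1r]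
  have hlogLN : Real.log (L * N) ≤ (1 + ε₁ / (4 * t)) * ℓ := by rw [hLN]; linarith
  have hlogLN2 : Real.log (L * N) ≤ 2 * ℓ := by
    have : ε₁ / (4 * t) * ℓ ≤ 1 * ℓ := by gcongr; linarith
    linarith
  have h8 : (1 - ε₁ / 2) * Real.log (L * N) ^ t ≤ ℓ ^ t := by
    have h1 : 0 ≤ 1 - ε₁ / 2 := by linarith
    calc (1 - ε₁ / 2) * Real.log (L * N) ^ t
        ≤ (1 - ε₁ / 2) * ((1 + ε₁ / (4 * t)) * ℓ) ^ t := by gcongr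
      _ = ((1 - ε₁ / 2) * (1 + ε₁ / (4 * t)) ^ t) * ℓ ^ t := by rw [mul_pow]; ring
      _ ≤ 1 * ℓ ^ t := by gcongr; exact mul_one_add_pow_le_one ht hε₁pos.le
      _ = ℓ ^ t := one_mul _
  -- the crude bounds are small: real-number bookkeeping
  set V : ℝ := (2 * (N : ℝ) + 1) ^ (d - 1) with hVdef
  set r : ℝ := (⌊ρ⌋₊ : ℝ) with hrdef
  set h : ℝ := (((Nat.sqrt (L * N) + 1) * (Nat.log 2 (L * N) + 1) : ℕ) : ℝ) with hhdef
  have hV : V ≤ 3 ^ (d - 1) * (N : ℝ) ^ (d - 1) := by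
    rw [hVdef, ← mul_pow]
    gcongr
    linarith
  have hr : r ≤ (N : ℝ) ^ θ := Nat.floor_le (by positivity)
  have hNsplit : (N : ℝ) ^ (1 - θ) * ((N : ℝ) ^ θ * (N : ℝ) ^ (d - 1)) = (N : ℝ) ^ d := by
    rw [← mul_assoc, ← Real.rpow_add hNr, sub_add_cancel, Real.rpow_one, ← pow_succ', hd']
  have hNsplit2 : (N : ℝ) ^ (1 / 2 : ℝ) * ((N : ℝ) ^ (1 / 2 : ℝ) * (N : ℝ) ^ (d - 1)) =
      (N : ℝ) ^ d := by
    rw [← mul_assoc, ← Real.rpow_add hNr, add_halves, Real.rpow_one, ← pow_succ', hd']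
  have hK4 : (t : ℝ) * 3 ^ (d - 1) * ℓ ^ t ≤ ε₁ / (8 * 2 ^ t) * (N : ℝ) ^ (1 - θ) := by
    calc (t : ℝ) * 3 ^ (d - 1) * ℓ ^ t
        = ε₁ / (8 * 2 ^ t) * ((8 * 2 ^ t * t * 3 ^ (d - 1) / ε₁) * ℓ ^ t) := by
          field_simp
      _ ≤ ε₁ / (8 * 2 ^ t) * (N : ℝ) ^ (1 - θ) := by gcongr
  have hK5 : 10 * 2 ^ t * t * 3 ^ (d - 1) * Real.sqrt L * ℓ ^ (t + 1) ≤
      ε₁ / 8 * (N : ℝ) ^ (1 / 2 : ℝ) := by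
    calc 10 * 2 ^ t * t * 3 ^ (d - 1) * Real.sqrt L * ℓ ^ (t + 1)
        = ε₁ / 8 * ((80 * 2 ^ t * t * 3 ^ (d - 1) * Real.sqrt L / ε₁) * ℓ ^ (t + 1)) := by
          field_simp
          ring
      _ ≤ ε₁ / 8 * (N : ℝ) ^ (1 / 2 : ℝ) := by gcongr
  have hh : h ≤ 10 * Real.sqrt L * ℓ * (N : ℝ) ^ (1 / 2 : ℝ) := by
    have hs : ((Nat.sqrt (L * N) : ℕ) : ℝ) ≤ Real.sqrt L * (N : ℝ) ^ (1 / 2 : ℝ) := by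
      calc ((Nat.sqrt (L * N) : ℕ) : ℝ) ≤ Real.sqrt ((L * N : ℕ) : ℝ) :=
            Real.nat_sqrt_le_real_sqrt
        _ = Real.sqrt L * Real.sqrt N := by rw [Nat.cast_mul, Real.sqrt_mul (by positivity)]
        _ = Real.sqrt L * (N : ℝ) ^ (1 / 2 : ℝ) := by rw [Real.sqrt_eq_rpow (N : ℝ)]
    have hs1 : (1 : ℝ) ≤ Real.sqrt L * (N : ℝ) ^ (1 / 2 : ℝ) :=
      one_le_mul_of_one_le_of_one_le (Real.one_le_sqrt.mpr hL1r)
        (Real.one_le_rpow (by linarith) (by norm_num))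
    have hk : ((Nat.log 2 (L * N) : ℕ) : ℝ) ≤ 4 * ℓ := by
      have hM : L * N ≠ 0 := (Nat.mul_pos hLpos hNpos).ne'
      have h2 : ((2 ^ Nat.log 2 (L * N) : ℕ) : ℝ) ≤ ((L * N : ℕ) : ℝ) := by
        exact_mod_cast Nat.pow_log_le_self 2 hM
      rw [Nat.cast_pow, Nat.cast_ofNat,
        Real.pow_le_iff_le_log (by norm_num) (by positivity), Nat.cast_mul] at h2
      have hlog2 : (1 / 2 : ℝ) < Real.log 2 := by
        have := Real.log_two_gt_d9
        linarith
      have hk0 : (0 : ℝ) ≤ Nat.log 2 (L * N) := Nat.cast_nonneg _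
      have hk1 : (Nat.log 2 (L * N) : ℝ) * (1 / 2) ≤ Nat.log 2 (L * N) * Real.log 2 :=
        mul_le_mul_of_nonneg_left hlog2.le hk0
      linarith
    calc h = (((Nat.sqrt (L * N) : ℕ) : ℝ) + 1) * (((Nat.log 2 (L * N) : ℕ) : ℝ) + 1) := by
          rw [hhdef]; push_cast; ring
      _ ≤ (Real.sqrt L * (N : ℝ) ^ (1 / 2 : ℝ) + Real.sqrt L * (N : ℝ) ^ (1 / 2 : ℝ)) *
            (4 * ℓ + ℓ) := by gcongr
      _ = 10 * Real.sqrt L * ℓ * (N : ℝ) ^ (1 / 2 : ℝ) := by ring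
  have hI : (t : ℝ) * (V * r) * ℓ ^ t ≤ ε₁ / (8 * 2 ^ t) * (N : ℝ) ^ d := by
    calc (t : ℝ) * (V * r) * ℓ ^ t
        ≤ t * ((3 ^ (d - 1) * (N : ℝ) ^ (d - 1)) * (N : ℝ) ^ θ) * ℓ ^ t := by gcongr
      _ = (t * 3 ^ (d - 1) * ℓ ^ t) * ((N : ℝ) ^ θ * (N : ℝ) ^ (d - 1)) := by ring
      _ ≤ (ε₁ / (8 * 2 ^ t) * (N : ℝ) ^ (1 - θ)) * ((N : ℝ) ^ θ * (N : ℝ) ^ (d - 1)) := by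
          gcongr
      _ = ε₁ / (8 * 2 ^ t) * (N : ℝ) ^ d := by rw [mul_assoc, hNsplit]
  have hBmax : (t : ℝ) * (V * r) * ℓ ^ t ≤ ε₁ / 4 * (N : ℝ) ^ d := by
    refine hI.trans ?_
    gcongr ?_ * _
    exact div_le_div_of_nonneg_left hε₁pos.le (by norm_num) (by linarith)
  have hII : 2 ^ t * t * ℓ ^ t * (V * h) ≤ ε₁ / 8 * (N : ℝ) ^ d := by
    calc 2 ^ t * t * ℓ ^ t * (V * h)
        ≤ 2 ^ t * t * ℓ ^ t * ((3 ^ (d - 1) * (N : ℝ) ^ (d - 1)) *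
            (10 * Real.sqrt L * ℓ * (N : ℝ) ^ (1 / 2 : ℝ))) := by
          gcongr
      _ = (10 * 2 ^ t * t * 3 ^ (d - 1) * Real.sqrt L * ℓ ^ (t + 1)) *
            ((N : ℝ) ^ (1 / 2 : ℝ) * (N : ℝ) ^ (d - 1)) := by ring
      _ ≤ (ε₁ / 8 * (N : ℝ) ^ (1 / 2 : ℝ)) * ((N : ℝ) ^ (1 / 2 : ℝ) * (N : ℝ) ^ (d - 1)) := by
          gcongr
      _ = ε₁ / 8 * (N : ℝ) ^ d := by rw [mul_assoc, hNsplit2]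
  have hBadr : (#((latticeBox d N).filter fun n =>
      ∃ i, (Ψ i).eval n ∈ Finset.Ioc (0 : ℤ) ⌊ρ⌋) : ℝ) ≤ t * (V * r) := by
    rw [hVdef, hrdef]
    exact_mod_cast hBad
  have hHPr : (#((latticeBox d N).filter fun n => ∃ i, ((Ψ i).eval n).toNat ∈
      (range (L * N + 1)).filter fun m => IsPrimePow m ∧ ¬ m.Prime) : ℝ) ≤ t * (V * h) := by
    rw [hVdef, hhdef]
    exact_mod_cast hHPc
  have hlogLNt : Real.log (L * N) ^ t ≤ 2 ^ t * ℓ ^ t := by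
    rw [← mul_pow]
    exact pow_le_pow_left₀ hlog0 hlogLN2 t
  have hR : ∑ n ∈ F \ Pg, ∏ i, intVonMangoldt ((Ψ i).eval n) ≤ ε₁ / 4 * (N : ℝ) ^ d := by
    calc ∑ n ∈ F \ Pg, ∏ i, intVonMangoldt ((Ψ i).eval n)
        ≤ _ := hRest
      _ ≤ (2 ^ t * ℓ ^ t) * (t * (V * r) + t * (V * h)) :=
          mul_le_mul hlogLNt (add_le_add hBadr hHPr) (by positivity) (by positivity)
      _ = 2 ^ t * (t * (V * r) * ℓ ^ t) + 2 ^ t * t * ℓ ^ t * (V * h) := by ring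
      _ ≤ 2 ^ t * (ε₁ / (8 * 2 ^ t) * (N : ℝ) ^ d) + ε₁ / 8 * (N : ℝ) ^ d := by gcongr
      _ = ε₁ / 4 * (N : ℝ) ^ d := by
          field_simp
          ring
  have hCr : (primePointCount Ψ K N : ℝ) ≤ #Pg + t * (V * r) := by
    have : (primePointCount Ψ K N : ℝ) ≤ #Pg + #((latticeBox d N).filter fun n =>
        ∃ i, (Ψ i).eval n ∈ Finset.Ioc (0 : ℤ) ⌊ρ⌋) := by exact_mod_cast hC2
    linarith
  -- endgame with `ε₁`, then relax to `ε`
  have hmain := count_endgame (t := t) (ε := ε₁) (Nd := (N : ℝ) ^ d) (ℓ := ℓ)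
    (ℓρ := Real.log ρ) (ℓL := Real.log (L * N)) (A := #Pg) (C := primePointCount Ψ K N)
    (Bmax := t * (V * r)) (S := vonMangoldtSum Ψ K N)
    (Wg := ∑ n ∈ Pg, ∏ i, intVonMangoldt ((Ψ i).eval n))
    (R := ∑ n ∈ F \ Pg, ∏ i, intVonMangoldt ((Ψ i).eval n))
    (X := archFactor Ψ K * singularProduct Ψ)
    hε₁pos hε₁1 (by positivity) hℓpos h7 h8 (Nat.cast_nonneg _) (by exact_mod_cast hC1) hCr
    hWg1 hWg2 hS hR0 hWg0 hG hBmax hR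
  have hX : 0 ≤ archFactor Ψ K * singularProduct Ψ + (N : ℝ) ^ d := by
    have h1 := (abs_le.mp hG).2
    have h2 : 0 ≤ vonMangoldtSum Ψ K N := by rw [hS]; exact add_nonneg hWg0 hR0
    have h3 : 0 ≤ (N : ℝ) ^ d := by positivity
    have h4 : ε₁ * (N : ℝ) ^ d ≤ 1 * (N : ℝ) ^ d := mul_le_mul_of_nonneg_right hε₁1 h3
    linarith
  calc |(primePointCount Ψ K N : ℝ) - archFactor Ψ K * singularProduct Ψ / ℓ ^ t|
      ≤ ε₁ * (archFactor Ψ K * singularProduct Ψ + (N : ℝ) ^ d) / ℓ ^ t := hmain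
    _ ≤ ε * (archFactor Ψ K * singularProduct Ψ + (N : ℝ) ^ d) / ℓ ^ t := by
        gcongr

end Literature.NumberTheory.Sieve
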